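import Literature.NumberTheory.EllipticCurves.RootNumberTwistResidualProofs
import HarnessLib

/-!
# `w(E/ℚ) = −∏_p w_p(E)`: decomposition of the named fact into the Modularity Theorem and the
# residual local statement at the additive primes of potentially good, non-twist type

Decomposition record (librarian, mode `fact-decompose`, 2026-08-16) for the XL named fact
`WeierstrassCurve.rootNumber_eq_algebraicRootNumber` (`RootNumber.lean`; Deligne 1973, Rohrlich
1994 §§19–21, Kellock–Dokchitser 2023 Def. 2.1: for an elliptic `W / ℚ` with no additive reduction
above `2, 3`, the analytic root number — the sign of the functional equation — equals
`−∏ᶠ_v w_v(E)` with Rohrlich's local root numbers).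

**State of the tree** (26 `RootNumber*` files of the fact's seat, all theorems): Hecke's
functional equation for newforms, Atkin–Lehner's `ε(f) = ∏_p λ_p(f)`, `λ_p = ±1` (Knapp 1993,
Thm. 9.27), Kellock–Dokchitser's Remark 2.2 `λ_p(f) = w_p(E)` at the multiplicative primes
(`atkinLehnerEigenvalueAt_eq_localRootNumberAt_of_not_sq_dvd`) and at the additive primes `p ≥ 5`
of quadratic-twist type (`atkinLehnerEigenvalueAt_eq_localRootNumberAt_of_twist`), and the assembly
`rootNumber_eq_algebraicRootNumber_of_exists_isNewformOf_of_residual`, whose two hypotheses are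
the Modularity Theorem and the residual statement (R) below.

**Decision: SPLIT into two children + proved glue.**

* child 1 (existing): `Literature.NumberTheory.EllipticCurves.ModularForms.exists_isNewformOf` —
  the Modularity Theorem (Breuil–Conrad–Diamond–Taylor 2001, Thm. A; itself reduced in
  `BCDTModularity` to Theorem B + CDT Thm. 7.2.4);
* child 2 (new): `WeierstrassCurve.atkinLehnerEigenvalueAt_eq_localRootNumberAt_residual` — (R):
  `λ_p(f) = w_p(E)` for the newform `f` of `E` at every additive prime `p ≥ 5` at which the
  quadratic twist `E^{(p*)}`, `p* = (−1)^{(p−1)/2} p`, is still additive (by Rohrlich 1993, Prop. 2: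
  potentially good reduction with `e = 12/gcd(v_p(Δ_min), 12) ∈ {3, 4, 6}`, where Remark 2.2 is local
  Langlands for `GL₂(ℚ_p)` at a ramified principal series / supercuspidal of conductor `p²`, with
  Carayol's local–global compatibility) — verbatim the hypothesis `hres` of the seat's assembly;
  strictly weaker than the per-prime named fact `atkinLehnerEigenvalueAt_eq_localRootNumberAt` (F1),
  of which it is exactly the unproved part;
* glue (proved): `rootNumber_eq_algebraicRootNumber_holds_of : exists_isNewformOf →
  W.atkinLehnerEigenvalueAt_eq_localRootNumberAt_residual → W.rootNumber_eq_algebraicRootNumber`.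

Neither child restates the parent (child 1 has no root numbers; child 2 is a per-prime identity
between an Atkin–Lehner eigenvalue and a local root number at a sparse set of primes, with no
functional equation). Size of child 2: XL as a theorem of local Langlands, but M–L along the
classical route actually available: at such `p` the curve acquires good reduction over a tame
extension of degree `e ∈ {3, 4, 6}` and `λ_p(f)`, `w_p(E)` can both be computed from the local
Weil(–Deligne) representation through its explicit induced/character description (Rohrlich 1993,
§§ 2–3; Kellock–Dokchitser 2023, Thm. 2.3; Pacetti 2013 / Connell for `λ_p` via `a_{p}` of twists).

## References

* L. Cowland Kellock, V. Dokchitser, *Root numbers and parity phenomena*, Bull. LMS 55 (2023),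
  Def. 2.1, Rem. 2.2, Thm. 2.3. [KellockDokchitser2023]
* D. Rohrlich, *Variation of the root number in families of elliptic curves*, Compositio Math. 87
  (1993), Prop. 2. [Rohrlich1993Compositio]
* C. Breuil, B. Conrad, F. Diamond, R. Taylor, JAMS 14 (2001), Thm. A. [BCDTJAMS2001]
* D. Rohrlich, *Elliptic curves and the Weil–Deligne group*, CRM Proc. 4 (1994), §§19–21.
  [Rohrlich1994CRM]
-/

noncomputable section

open scoped MatrixGroups Classical

open CongruenceSubgroup Literature.NumberTheory.EllipticCurves.ModularForms IsDedekindDomain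
  IsDedekindDomain.HeightOneSpectrum Rat.HeightOneSpectrum

namespace WeierstrassCurve

variable (W : WeierstrassCurve ℚ)

/-- **(R) — Kellock–Dokchitser's Remark 2.2 at the additive primes `p ≥ 5` of non-twist type**
(named fact, child 2 of the decomposition of `rootNumber_eq_algebraicRootNumber`; the residual,
unproved part of `atkinLehnerEigenvalueAt_eq_localRootNumberAt`). For an elliptic `W / ℚ`, its
newform `f ∈ S₂(Γ₀(N_W))` (`IsNewformOf W f`) and every prime `p ≥ 5` at which `W` has additive
reduction AND the quadratic twist `W^{(p*)}`, `p* = (−1)^{⌊p/2⌋} p`, still has additive reduction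
(equivalently, by Rohrlich 1993, Prop. 2: potentially good reduction at `p` with
`e = 12 / gcd(v_p(Δ_min), 12) ∈ {3, 4, 6}`), the Atkin–Lehner eigenvalue at `p` equals Rohrlich's
local root number: `λ_p(f) = w_p(E)` (`atkinLehnerEigenvalueAt f p = W.localRootNumberAt v_p`, where
`w_p(E) = (−3/p), (−2/p), (−1/p)` for `e = 3, 4, 6`). Printed: "For an elliptic curve defined over
`ℚ`, the local root number at a prime `p` agrees with the eigenvalue of the associated Atkin–Lehner
involution for the associated modular form. This follows from the corresponding statement for
modular forms ([Schmidt 2002] Theorem 3.2.2) together with the local Langlands [correspondence, a theorem for `GL₂`: Kutzko 1980] for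
`GL₂` and the modularity of elliptic curves over `ℚ`" (Kellock–Dokchitser 2023, Rem. 2.2) — here
only at the primes not already covered by theorems of the tree (multiplicative primes:
`atkinLehnerEigenvalueAt_eq_localRootNumberAt_of_not_sq_dvd`; additive primes of quadratic-twist
type: `atkinLehnerEigenvalueAt_eq_localRootNumberAt_of_twist`). Verbatim the hypothesis `hres` of
`rootNumber_eq_algebraicRootNumber_of_exists_isNewformOf_of_residual`.
[cite: KellockDokchitser2023, Rem. 2.2 and Thm. 2.3] [cite: Rohrlich1993Compositio, Prop. 2 (iv)] -/
def atkinLehnerEigenvalueAt_eq_localRootNumberAt_residual : Prop :=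
  ∀ [W.IsElliptic] [NeZero (W.conductorNorm ℤ)] {f : CuspForm (Gamma0 (W.conductorNorm ℤ)) 2}
    (_hf : IsNewformOf W f) (p : Nat.Primes), 5 ≤ (p : ℕ) →
    W.HasAdditiveReductionAt ((primesEquiv (R := ℤ)).symm p) →
    (W.quadraticTwist (((-1 : ℤ) ^ ((p : ℕ) / 2) * p : ℤ) : ℚ)).HasAdditiveReductionAt
      ((primesEquiv (R := ℤ)).symm p) →
    atkinLehnerEigenvalueAt f p = (W.localRootNumberAt ((primesEquiv (R := ℤ)).symm p) : ℂ)

/-- **Glue of the decomposition of `rootNumber_eq_algebraicRootNumber`**: `w(E) = −∏_p w_p(E)`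
for an elliptic `W / ℚ` with no additive reduction above `2, 3` follows from the Modularity
Theorem (`exists_isNewformOf`, BCDT 2001 Thm. A) and the residual local statement (R)
(`atkinLehnerEigenvalueAt_eq_localRootNumberAt_residual`), by the seat's
`rootNumber_eq_algebraicRootNumber_of_exists_isNewformOf_of_residual` (Hecke, Atkin–Lehner,
Remark 2.2 at the multiplicative and twist-type primes, the local product formula and the sign
comparison being theorems of the tree). [cite: KellockDokchitser2023, Def. 2.1 and Rem. 2.2]
[cite: BCDTJAMS2001, Theorem A] [cite: Rohrlich1994CRM, §20] -/
theorem rootNumber_eq_algebraicRootNumber_holds_of (hmod : exists_isNewformOf)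
    (hres : W.atkinLehnerEigenvalueAt_eq_localRootNumberAt_residual) :
    W.rootNumber_eq_algebraicRootNumber :=
  W.rootNumber_eq_algebraicRootNumber_of_exists_isNewformOf_of_residual hmod
    (fun hf p hp hadd htw => hres hf p hp hadd htw)

/-- Likewise the functional equation with the algebraic sign, `Λ(E, 2 − s) = −∏_p w_p(E) · Λ(E, s)`,
from the two children (`hasFunctionalEquationSign_algebraicRootNumber_of_residual`).
[cite: KellockDokchitser2023, Def. 2.1 and Rem. 2.2] -/
theorem hasFunctionalEquationSign_algebraicRootNumber_of_children (hmod : exists_isNewformOf)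
    (hres : W.atkinLehnerEigenvalueAt_eq_localRootNumberAt_residual) [W.IsElliptic]
    (h23 : ∀ v : HeightOneSpectrum ℤ, W.HasAdditiveReductionAt v → 3 < ringChar (ℤ ⧸ v.asIdeal)) :
    W.HasFunctionalEquationSign W.algebraicRootNumber :=
  W.hasFunctionalEquationSign_algebraicRootNumber_of_residual hmod h23
    (fun hf p hp hadd htw => hres hf p hp hadd htw)

end WeierstrassCurve

end
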